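import Literature.NumberTheory.EllipticCurves.PAdicOneVariableSupportOfColemanTraceTwo
import Literature.NumberTheory.PAdicHodge.CompletedAlgClosurePadicComplexTransport
import HarnessLib

/-!
# `F = ℚ₂`: Coleman's `𝒮_{f'} h = 0` ⟹ the measure of `θ(h ∘ ϑ)` lives on `ℤ₂^×`, with the socket — the
# hypotheses of `PAdicOneVariableSupportOfColemanTraceTwo.lean` discharged for Mathlib's `ℚ_[2]` and the
# canonical `θ : ℂ_{ℚ₂} ≃ ℂ_[2]`

Topic `NumberTheory/EllipticCurves`; namespace `Literature.NumberTheory.EllipticCurves.PadicTwo`.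

De Shalit, *Iwasawa theory of elliptic curves with complex multiplication* (1987), I.3.3 (7) ⟺ (7′), I.3.5 (11),
at the split prime `p = 2` over `K_𝔭 = ℚ₂`.  The generic plug file takes a local field `F` with `|𝓀_F| = 2` and `2`
a uniformiser, and a continuous ring map `θ : ℂ_F → ℂ_[2]` of norm `≤ 1` on `𝒪_{ℂ_F}` reaching the `2`-power roots
of unity.  Here `F := ℚ_[2]` (tree `Padic.isNonarchimedeanLocalField_holds`, `Padic.residueFieldCard_eq`,
`Padic.isUniformizer_natCast`) and `θ := CompletedAlgClosure.equivPadicComplex 2` (tree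
`CompletedAlgClosurePadicComplex*.lean`: bicontinuous, unit balls correspond, roots of unity correspond):

* `continuous_equivPadicComplex_toRingHom`, `norm_equivPadicComplex_coe_cBall_le_one`,
  `exists_pow_two_pow_eq_one_equivPadicComplex_eq` — the three `θ`-hypotheses;
* ★★★ `invAmice₁_μ_eq_zero_of_colemanTrace_eq_zero` — for every uniformiser `π' = 2u` of `ℤ₂`, every
  arithmetic Frobenius `σ₀` with Lang unit `ε` (`σ₀ ε = u ε`), and every `h₀ ∈ ℤ₂⟦X⟧` with `𝒮_{f'} h₀ = 0`
  (`f' = π'X + X²`): the distribution of `θ(h₀ ∘ ϑ) ∈ ℂ_2⟦S⟧` vanishes on every non-unit class of `ℤ/2^{N+1}`;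
* ★★★ `integral_restrictUnits_density_unitInv_pow_succ_of_colemanTrace_eq_zero` — the socket
  `∫ x^{k+1} d(restrictUnits (x⁻¹ · D)) = [S^0] D^k` for that series.

Everything is proved; no named facts, no definitions, no instances, no `sorry`.

## References

* [deShalit1987] E. de Shalit, *Iwasawa theory of elliptic curves with complex multiplication* (1987),
  I.3.3 (7)–(8) (p. 17–18), I.3.5 (11) (p. 18).
-/

noncomputable section

open MvPowerSeries Filter
open scoped PowerSeries.WithPiTopology Topology

namespace Literature.NumberTheory.EllipticCurves

namespace PadicTwo

open ValuativeRel IsLocalRing Field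
open Literature.NumberTheory.GaloisRepresentations Literature.NumberTheory.GaloisRepresentations.IsNonarchimedeanLocalField
  Literature.NumberTheory.GaloisRepresentations.LubinTate Literature.NumberTheory.PAdicHodge

attribute [local instance] ltNormUniformSpace ltNormIsUniformAddGroup rk1 nF nE fintypeResidueField

/-- `θ : ℂ_{ℚ₂} → ℂ_[2]` is continuous (as a ring map). [cite: deShalit1987, I.3.3 (7′) (p. 17)] -/
theorem continuous_equivPadicComplex_toRingHom :
    haveI := Padic.isNonarchimedeanLocalField_holds 2
    Continuous ((CompletedAlgClosure.equivPadicComplex 2).toRingHom :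
      CompletedAlgClosure ℚ_[2] →+* ℂ_[2]) := by
  haveI := Padic.isNonarchimedeanLocalField_holds 2
  exact CompletedAlgClosure.continuous_equivPadicComplex 2

/-- `θ` has norm `≤ 1` on `𝒪_{ℂ_{ℚ₂}}`. [cite: deShalit1987, I.3.3 (7′) (p. 17)] -/
theorem norm_equivPadicComplex_coe_cBall_le_one :
    haveI := Padic.isNonarchimedeanLocalField_holds 2
    ∀ z : CBall ℚ_[2], ‖(CompletedAlgClosure.equivPadicComplex 2).toRingHom (z : CompletedAlgClosure ℚ_[2])‖ ≤ 1 := by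
  haveI := Padic.isNonarchimedeanLocalField_holds 2
  intro z
  exact (CompletedAlgClosure.norm_equivPadicComplex_le_one_iff 2 _).mpr ((mem_unitBall_iff _).mp z.2)

/-- Every `2`-power root of unity of `ℂ_[2]` is the `θ`-image of one of `ℂ_{ℚ₂}`.
[cite: deShalit1987, I.3.3 (7′) (p. 17)] -/
theorem exists_pow_two_pow_eq_one_equivPadicComplex_eq :
    haveI := Padic.isNonarchimedeanLocalField_holds 2
    ∀ ζ' : ℂ_[2], (∃ n : ℕ, ζ' ^ 2 ^ n = 1) →
      ∃ ζ : CompletedAlgClosure ℚ_[2], (∃ n : ℕ, ζ ^ 2 ^ n = 1) ∧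
        (CompletedAlgClosure.equivPadicComplex 2).toRingHom ζ = ζ' := by
  haveI := Padic.isNonarchimedeanLocalField_holds 2
  rintro ζ' ⟨n, hn⟩
  refine ⟨(CompletedAlgClosure.equivPadicComplex 2).symm ζ', ⟨n, ?_⟩, ?_⟩
  · exact (equivPadicComplex_symm_pow_eq_one_iff 2 ζ' (2 ^ n)).mpr hn
  · exact (CompletedAlgClosure.equivPadicComplex 2).apply_symm_apply ζ'

/-- ★★★ **`F = ℚ₂`: `𝒮_{f'} h₀ = 0 ⟹ D_{θ(h₀∘ϑ)}` vanishes on every non-unit class** (`f' = π'X + X²`,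
`π' = 2u`, `u ∈ ℤ₂^×`; `ϑ : Ĝ_m → F_{f'}` the comparison series for an arithmetic Frobenius `σ₀` and a Lang unit
`ε`): de Shalit's (7) ⟹ (7′) at `p = 2` in the kernel, from Coleman's trace operator to Mathlib's `ℂ_[2]`.
[cite: deShalit1987, I.3.3 (7)–(7′) (p. 17)] -/
theorem invAmice₁_μ_eq_zero_of_colemanTrace_eq_zero :
    haveI := Padic.isNonarchimedeanLocalField_holds 2
    ∀ {σ₀ : absoluteGaloisGroup ℚ_[2]} (hσ₀ : IsAbsArithFrob σ₀) (u : 𝒪[ℚ_[2]]ˣ)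
      {ε : (maxUnramifiedCompletion ℚ_[2])ˣ}
      (hε : maxUnramifiedCompletion.galAut ℚ_[2] σ₀ (ε : maxUnramifiedCompletion ℚ_[2]) =
        algebraMap 𝒪[ℚ_[2]] (maxUnramifiedCompletion ℚ_[2]) (u : 𝒪[ℚ_[2]]) * (ε : maxUnramifiedCompletion ℚ_[2]))
      (n : ℕ) (h₀ : PowerSeries (LTCoeff ℚ_[2]))
      (_hS : colemanTrace (isUniformizer_unit_mul (Padic.isUniformizer_natCast 2) u) n h₀ = 0)
      (N : ℕ) (b : ZMod (2 ^ (N + 1))), ¬IsUnit b →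
      (invAmice₁ 2
        ((PowerSeries.subst ((compSeriesC (Padic.isUniformizer_natCast 2) hσ₀ u hε).map
            (algebraMap (UnrCoeff ℚ_[2]) (CBall ℚ_[2])))
          (h₀.map ((algebraMap (UnrCoeff ℚ_[2]) (CBall ℚ_[2])).comp
            ((intToUnrCoeff ℚ_[2]).comp (LTCoeff.of ℚ_[2]).symm.toRingHom)))).map
          ((CompletedAlgClosure.equivPadicComplex 2).toRingHom.comp (CBall ℚ_[2]).subtype))
        (norm_coeff_map_le_one _ norm_equivPadicComplex_coe_cBall_le_one _)).μ (N + 1) b = 0 := by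
  haveI := Padic.isNonarchimedeanLocalField_holds 2
  intro σ₀ hσ₀ u ε hε n h₀ hS N b hb
  exact Literature.NumberTheory.EllipticCurves.invAmice₁_μ_eq_zero_of_colemanTrace_eq_zero
    (Padic.residueFieldCard_eq 2) (Padic.isUniformizer_natCast 2) hσ₀ u hε _
    continuous_equivPadicComplex_toRingHom norm_equivPadicComplex_coe_cBall_le_one
    exists_pow_two_pow_eq_one_equivPadicComplex_eq n h₀ hS N b hb

/-- ★★★ **`F = ℚ₂`: THE SOCKET from `𝒮_{f'} h₀ = 0`** — for `H' := θ(h₀ ∘ ϑ) ∈ ℂ_2⟦S⟧` and every `k`,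
`∫ x^{k+1} d(restrictUnits (x⁻¹ · D_{H'})) = [S^0] D^k H'` (de Shalit's (11) for `μ_β♭`).
[cite: deShalit1987, I.3.5 (11) (p. 18), I.3.3 (7)–(8) (p. 17)] -/
theorem integral_restrictUnits_density_unitInv_pow_succ_of_colemanTrace_eq_zero :
    haveI := Padic.isNonarchimedeanLocalField_holds 2
    ∀ {σ₀ : absoluteGaloisGroup ℚ_[2]} (hσ₀ : IsAbsArithFrob σ₀) (u : 𝒪[ℚ_[2]]ˣ)
      {ε : (maxUnramifiedCompletion ℚ_[2])ˣ}
      (hε : maxUnramifiedCompletion.galAut ℚ_[2] σ₀ (ε : maxUnramifiedCompletion ℚ_[2]) =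
        algebraMap 𝒪[ℚ_[2]] (maxUnramifiedCompletion ℚ_[2]) (u : 𝒪[ℚ_[2]]) * (ε : maxUnramifiedCompletion ℚ_[2]))
      (n : ℕ) (h₀ : PowerSeries (LTCoeff ℚ_[2]))
      (_hS : colemanTrace (isUniformizer_unit_mul (Padic.isUniformizer_natCast 2) u) n h₀ = 0) (k : ℕ),
      (restrictUnits ((invAmice₁ 2
        ((PowerSeries.subst ((compSeriesC (Padic.isUniformizer_natCast 2) hσ₀ u hε).map
            (algebraMap (UnrCoeff ℚ_[2]) (CBall ℚ_[2])))
          (h₀.map ((algebraMap (UnrCoeff ℚ_[2]) (CBall ℚ_[2])).comp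
            ((intToUnrCoeff ℚ_[2]).comp (LTCoeff.of ℚ_[2]).symm.toRingHom)))).map
          ((CompletedAlgClosure.equivPadicComplex 2).toRingHom.comp (CBall ℚ_[2]).subtype))
        (norm_coeff_map_le_one _ norm_equivPadicComplex_coe_cBall_le_one _)).density
        (ProfiniteTower.padicInt_isUniform 2) (unitInv ℂ_[2]) uniformContinuous_unitInv norm_unitInv_le)).integral
        (fun x ↦ padicIntCast ℂ_[2] (x ^ (k + 1))) =
      PowerSeries.constantCoeff (mahlerD^[k]
        ((PowerSeries.subst ((compSeriesC (Padic.isUniformizer_natCast 2) hσ₀ u hε).map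
            (algebraMap (UnrCoeff ℚ_[2]) (CBall ℚ_[2])))
          (h₀.map ((algebraMap (UnrCoeff ℚ_[2]) (CBall ℚ_[2])).comp
            ((intToUnrCoeff ℚ_[2]).comp (LTCoeff.of ℚ_[2]).symm.toRingHom)))).map
          ((CompletedAlgClosure.equivPadicComplex 2).toRingHom.comp (CBall ℚ_[2]).subtype))) := by
  haveI := Padic.isNonarchimedeanLocalField_holds 2
  intro σ₀ hσ₀ u ε hε n h₀ hS k
  exact Literature.NumberTheory.EllipticCurves.integral_restrictUnits_density_unitInv_pow_succ_of_colemanTrace_eq_zero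
    (Padic.residueFieldCard_eq 2) (Padic.isUniformizer_natCast 2) hσ₀ u hε _
    continuous_equivPadicComplex_toRingHom norm_equivPadicComplex_coe_cBall_le_one
    exists_pow_two_pow_eq_one_equivPadicComplex_eq n h₀ hS k

end PadicTwo

end Literature.NumberTheory.EllipticCurves

end
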